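import Summits.QuantumFields.YangMills.Theses.RecentredCoverTransfer
import Summits.QuantumFields.YangMills.Theorems.RecentredCoverTransferCellTranslation
import HarnessLib

/-!
# Route `RecentredCoverTransfer` (LINE g9-A of planner ym-idea-1 g9), support item `CellMeanShiftInvariant` (stmt-QuantumFields-23122)

Cell-translation invariance of skew-torus Wilson means: `∫ O(τ_x lift_C U) dμ_C = ∫ O(lift_C U) dμ_C` for every period cell `C`,
representation `ρ`, coupling `β`, observable `O` and lattice vector `x` — the theorem `integral_comp_configShift_lift` of the kit
`Theorems/RecentredCoverTransferCellTranslation` (the cell translation `t ↦ toRep (t + x)` is a measurable automorphism of `C.Config G`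
preserving the product Haar measure and the Wilson action, hence `C.measure`; no continuity or integrability hypothesis is needed).

Width seat ym-line-sfw-p2-w3 g28 (cell ym-idea-1; free hands).  THEOREMS ONLY.  No crux, no rung (R2d ROT is a RECORD rung), no summit
and no mass gap is proved by this.
-/

set_option autoImplicit false

namespace Summit.QuantumFields.YangMills.Theorems.RecentredCoverTransfer

/-- **Item stmt-QuantumFields-23122 `RecentredCoverTransfer.CellMeanShiftInvariant` holds**: the skew-torus Wilson state read through
the periodic lift is invariant under every lattice translation. [folklore] -/
theorem cellMeanShiftInvariant_proof :
    Summit.QuantumFields.YangMills.Theses.RecentredCoverTransfer.CellMeanShiftInvariant := by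
  intro G _ _ _ _ _ _ N ρ C β O x
  exact integral_comp_configShift_lift C ρ β x O

end Summit.QuantumFields.YangMills.Theorems.RecentredCoverTransfer
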